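import Literature.Computability.MetaComplexity.LevelledRefutationCNFAxioms
import HarnessLib

/-!
# Garlík's adversary for `REF^F_{s,t}`: admissible assignments

Support file for the proof of `levelledRefCNF_lowerBound` ([Garlík 2019, Thm 1]). This file sets
up the deterministic half of [Garlík 2019, §4]: *admissible* partial assignments
([Garlík 2019, Def. 15]), the bookkeeping of *mentioned / important* pairs of a clause
([Garlík 2019, Def. 13]), the fact that an admissible assignment falsifies no axiom of
`REF^F_{s,t}` ([Garlík 2019, Lemma 16]) in the form consumed by the backward walk through a
refutation, and the generic backward walk itself (the "this is a contradiction" paragraph before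
[Garlík 2019, Lemma 16]).

## Design (deviations from the printed text, all inessential)

* Partial assignments to the variables of `REF^F_{s,t}` are *structured* (`PA`): for every pair
  `(i,j)` an optional clause for the group `D(i,j,·,·)`, an optional cut variable for `V(i,j,·)`,
  an optional premise for `L(i,j,·)` / `R(i,j,·)`, and for every `j` an optional clause index
  for `I(j,·)`. The induced partial truth assignment is `PA.eval`; condition (C1) of
  [Garlík 2019, Def. 15] ("each group is either set to a value or untouched") holds by
  construction, and (C9) (the premise maps are partial injections) is stated directly.
* We work with refutations of the `ℕ`-coded formula `levelledRefCNF F s t`; a variable of a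
  refutation clause that is not the code of an in-range variable is never assigned (`eval` is
  `none` there) and never counted, so it is inert in the whole argument.
* Indices are 0-based as in `LevelledRefutationCNF.lean` (level `0` is the axiom level).
* The restriction `ρ` is not applied to the refutation: instead the invariant quantifies over
  admissible assignments *extending* `ρ` (`Ext ρ σ`), and a clause all of whose assigned literals
  are falsified by such a `σ` is in particular not satisfied by `ρ`, which is how the width
  bounds of [Garlík 2019, Lemma 14] enter ([Garlík 2019, Lemma 19]).

Contents: `Params`, `PA`, `PA.eval`, `Admissible` (C2)–(C9), `Ext`, `Falsi`, `SatBy`, the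
importance predicates `DMen/VImp/IImp/LImp/RImp`, `Covered`, the width record `Narrow`, the
sparsity record `LevelSparse`, monotonicity lemmas, `not_axiom_of_covered` (Lemma 16 + the
observation that a covered, falsified-where-assigned axiom would be falsified), and the backward
walk `no_refutation_of_invariant`.

## References

* M. Garlík, *Resolution lower bounds for refutation statements*, MFCS 2019 / arXiv:1905.12372,
  §4, Def. 13, Def. 15, Lemma 16, Lemma 19.
-/

namespace Literature.Computability.MetaComplexity

open _root_.Computability Complexity

namespace LevelledRefCNF

/-! ### Parameters and structured partial assignments -/

/-- The size parameters of `REF^F_{s,t}`: `n` variables and `r` clauses of `F`, `s` levels of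
`t` clauses. [cite: Garlik2019, §3] -/
structure Params where
  /-- number of variables of `F` -/
  n : ℕ
  /-- number of clauses of `F` -/
  r : ℕ
  /-- number of levels -/
  s : ℕ
  /-- number of clauses per level -/
  t : ℕ

/-- A *structured partial assignment* to the variables of `REF^F_{s,t}`: the group
`D(i,j,·,·)` is unset or set to a clause (a set of literals `(ℓ, b)` = `x_ℓ^b`), `V(i,j,·)` is
unset or set to a variable index, `I(j,·)` to a clause index, `L(i,j,·)` / `R(i,j,·)` to a
position of the previous level. [cite: Garlik2019, Def. 8 ("set to"), Def. 15 (C1)] -/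
structure PA where
  /-- the clause `C_{i,j}`, if `D(i,j,·,·)` is set -/
  D : ℕ × ℕ → Option (Finset (ℕ × Bool))
  /-- the cut variable of `C_{i,j}`, if `V(i,j,·)` is set -/
  V : ℕ × ℕ → Option ℕ
  /-- the clause of `F` assigned to `C_{1,j}`, if `I(j,·)` is set -/
  I : ℕ → Option ℕ
  /-- the `L`-premise of `C_{i,j}`, if `L(i,j,·)` is set -/
  L : ℕ × ℕ → Option ℕ
  /-- the `R`-premise of `C_{i,j}`, if `R(i,j,·)` is set -/
  R : ℕ × ℕ → Option ℕ

/-- The everywhere-undefined structured assignment. [folklore] -/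
def PA.empty : PA := ⟨fun _ => none, fun _ => none, fun _ => none, fun _ => none, fun _ => none⟩

/-- The partial truth assignment induced by a structured assignment (only in-range variables
are ever assigned). [cite: Garlik2019, Def. 8] -/
def PA.eval (P : Params) (σ : PA) : LRefVar → Option Bool
  | .D i j ℓ b => if i < P.s ∧ j < P.t ∧ ℓ < P.n then
      (σ.D (i, j)).map (fun C => decide ((ℓ, b) ∈ C)) else none
  | .V i j ℓ => if 1 ≤ i ∧ i < P.s ∧ j < P.t ∧ ℓ < P.n then
      (σ.V (i, j)).map (fun k => decide (k = ℓ)) else none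
  | .I j m => if j < P.t ∧ m < P.r then (σ.I j).map (fun k => decide (k = m)) else none
  | .L i j j' => if 1 ≤ i ∧ i < P.s ∧ j < P.t ∧ j' < P.t then
      (σ.L (i, j)).map (fun k => decide (k = j')) else none
  | .R i j j' => if 1 ≤ i ∧ i < P.s ∧ j < P.t ∧ j' < P.t then
      (σ.R (i, j)).map (fun k => decide (k = j')) else none

section EvalLemmas

variable {P : Params} {σ : PA}

/-- Value of a `D`-variable of a set group. [folklore] -/
theorem PA.eval_D {i j ℓ : ℕ} {b : Bool} {C : Finset (ℕ × Bool)} (hC : σ.D (i, j) = some C)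
    (hi : i < P.s) (hj : j < P.t) (hℓ : ℓ < P.n) :
    σ.eval P (.D i j ℓ b) = some (decide ((ℓ, b) ∈ C)) := by
  simp [PA.eval, hC, hi, hj, hℓ]

/-- Value of a `V`-variable of a set group. [folklore] -/
theorem PA.eval_V {i j ℓ k : ℕ} (hk : σ.V (i, j) = some k) (h1 : 1 ≤ i) (hi : i < P.s)
    (hj : j < P.t) (hℓ : ℓ < P.n) : σ.eval P (.V i j ℓ) = some (decide (k = ℓ)) := by
  simp [PA.eval, hk, h1, hi, hj, hℓ]

/-- Value of an `I`-variable of a set group. [folklore] -/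
theorem PA.eval_I {j m k : ℕ} (hk : σ.I j = some k) (hj : j < P.t) (hm : m < P.r) :
    σ.eval P (.I j m) = some (decide (k = m)) := by
  simp [PA.eval, hk, hj, hm]

/-- Value of an `L`-variable of a set group. [folklore] -/
theorem PA.eval_L {i j j' k : ℕ} (hk : σ.L (i, j) = some k) (h1 : 1 ≤ i) (hi : i < P.s)
    (hj : j < P.t) (hj' : j' < P.t) : σ.eval P (.L i j j') = some (decide (k = j')) := by
  simp [PA.eval, hk, h1, hi, hj, hj']

/-- Value of an `R`-variable of a set group. [folklore] -/
theorem PA.eval_R {i j j' k : ℕ} (hk : σ.R (i, j) = some k) (h1 : 1 ≤ i) (hi : i < P.s)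
    (hj : j < P.t) (hj' : j' < P.t) : σ.eval P (.R i j j') = some (decide (k = j')) := by
  simp [PA.eval, hk, h1, hi, hj, hj']

/-- A `D`-variable of an unset group is unassigned. [folklore] -/
theorem PA.eval_D_none {i j ℓ : ℕ} {b : Bool} (h : σ.D (i, j) = none) :
    σ.eval P (.D i j ℓ b) = none := by
  simp [PA.eval, h]

/-- A `V`-variable of an unset group is unassigned. [folklore] -/
theorem PA.eval_V_none {i j ℓ : ℕ} (h : σ.V (i, j) = none) : σ.eval P (.V i j ℓ) = none := by
  simp [PA.eval, h]

/-- An `I`-variable of an unset group is unassigned. [folklore] -/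
theorem PA.eval_I_none {j m : ℕ} (h : σ.I j = none) : σ.eval P (.I j m) = none := by
  simp [PA.eval, h]

/-- An `L`-variable of an unset group is unassigned. [folklore] -/
theorem PA.eval_L_none {i j j' : ℕ} (h : σ.L (i, j) = none) : σ.eval P (.L i j j') = none := by
  simp [PA.eval, h]

/-- An `R`-variable of an unset group is unassigned. [folklore] -/
theorem PA.eval_R_none {i j j' : ℕ} (h : σ.R (i, j) = none) : σ.eval P (.R i j j') = none := by
  simp [PA.eval, h]

/-- If a `D`-variable is assigned then its indices are in range and its group is set.
[folklore] -/
theorem PA.eval_D_isSome {i j ℓ : ℕ} {b v : Bool} (h : σ.eval P (.D i j ℓ b) = some v) :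
    i < P.s ∧ j < P.t ∧ ℓ < P.n ∧ ∃ C, σ.D (i, j) = some C ∧ v = decide ((ℓ, b) ∈ C) := by
  simp only [PA.eval] at h
  split_ifs at h with hc
  · cases hD : σ.D (i, j) with
    | none => simp [hD] at h
    | some C =>
      simp only [hD, Option.map_some, Option.some.injEq] at h
      exact ⟨hc.1, hc.2.1, hc.2.2, C, rfl, h.symm⟩

/-- If a `V`-variable is assigned then its indices are in range and its group is set.
[folklore] -/
theorem PA.eval_V_isSome {i j ℓ : ℕ} {v : Bool} (h : σ.eval P (.V i j ℓ) = some v) :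
    1 ≤ i ∧ i < P.s ∧ j < P.t ∧ ℓ < P.n ∧ ∃ k, σ.V (i, j) = some k ∧ v = decide (k = ℓ) := by
  simp only [PA.eval] at h
  split_ifs at h with hc
  · cases hV : σ.V (i, j) with
    | none => simp [hV] at h
    | some k =>
      simp only [hV, Option.map_some, Option.some.injEq] at h
      exact ⟨hc.1, hc.2.1, hc.2.2.1, hc.2.2.2, k, rfl, h.symm⟩

/-- If an `I`-variable is assigned then its indices are in range and its group is set.
[folklore] -/
theorem PA.eval_I_isSome {j m : ℕ} {v : Bool} (h : σ.eval P (.I j m) = some v) :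
    j < P.t ∧ m < P.r ∧ ∃ k, σ.I j = some k ∧ v = decide (k = m) := by
  simp only [PA.eval] at h
  split_ifs at h with hc
  · cases hI : σ.I j with
    | none => simp [hI] at h
    | some k =>
      simp only [hI, Option.map_some, Option.some.injEq] at h
      exact ⟨hc.1, hc.2, k, rfl, h.symm⟩

/-- If an `L`-variable is assigned then its indices are in range and its group is set.
[folklore] -/
theorem PA.eval_L_isSome {i j j' : ℕ} {v : Bool} (h : σ.eval P (.L i j j') = some v) :
    1 ≤ i ∧ i < P.s ∧ j < P.t ∧ j' < P.t ∧ ∃ k, σ.L (i, j) = some k ∧ v = decide (k = j') := by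
  simp only [PA.eval] at h
  split_ifs at h with hc
  · cases hL : σ.L (i, j) with
    | none => simp [hL] at h
    | some k =>
      simp only [hL, Option.map_some, Option.some.injEq] at h
      exact ⟨hc.1, hc.2.1, hc.2.2.1, hc.2.2.2, k, rfl, h.symm⟩

/-- If an `R`-variable is assigned then its indices are in range and its group is set.
[folklore] -/
theorem PA.eval_R_isSome {i j j' : ℕ} {v : Bool} (h : σ.eval P (.R i j j') = some v) :
    1 ≤ i ∧ i < P.s ∧ j < P.t ∧ j' < P.t ∧ ∃ k, σ.R (i, j) = some k ∧ v = decide (k = j') := by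
  simp only [PA.eval] at h
  split_ifs at h with hc
  · cases hR : σ.R (i, j) with
    | none => simp [hR] at h
    | some k =>
      simp only [hR, Option.map_some, Option.some.injEq] at h
      exact ⟨hc.1, hc.2.1, hc.2.2.1, hc.2.2.2, k, rfl, h.symm⟩

end EvalLemmas

/-! ### Admissible assignments -/

/-- **Admissible structured assignments** [Garlík 2019, Def. 15], for the parameters `P` and
the clauses `Fc m = C_m` of `F` (0-based levels; (C1) is built into `PA`):
ranges — only in-range groups are set, to in-range values;
(C2) a set premise has both endpoint clauses set; (C3) a set clause has its cut variable
(level `≥ 1`) or its `F`-clause (level `0`) set; (C4) set clauses are non-tautological, have at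
least `min(s-1-i, n)` literals, and a non-full set clause avoids its cut variable;
(C5) the last clause, if set, is empty; (C6) a level-`0` clause contains its `F`-clause;
(C7) the `L`- (`R`-) premise contains the cut variable positively (negatively);
(C8) the conclusion keeps all other literals of its premises; (C9) on each level the premise
maps form a partial injection. [cite: Garlik2019, Def. 15] -/
structure Admissible (P : Params) (Fc : ℕ → Finset (ℕ × Bool)) (σ : PA) : Prop where
  /-- range of `D` -/
  D_range : ∀ i j C, σ.D (i, j) = some C →
    i < P.s ∧ j < P.t ∧ C ⊆ Finset.range P.n ×ˢ Finset.univ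
  /-- range of `V` -/
  V_range : ∀ i j k, σ.V (i, j) = some k → 1 ≤ i ∧ i < P.s ∧ j < P.t ∧ k < P.n
  /-- range of `I` -/
  I_range : ∀ j k, σ.I j = some k → j < P.t ∧ k < P.r
  /-- range of `L` -/
  L_range : ∀ i j k, σ.L (i, j) = some k → 1 ≤ i ∧ i < P.s ∧ j < P.t ∧ k < P.t
  /-- range of `R` -/
  R_range : ∀ i j k, σ.R (i, j) = some k → 1 ≤ i ∧ i < P.s ∧ j < P.t ∧ k < P.t
  /-- (C2) for `L` -/
  L_D : ∀ p j k, σ.L (p + 1, j) = some k → σ.D (p + 1, j) ≠ none ∧ σ.D (p, k) ≠ none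
  /-- (C2) for `R` -/
  R_D : ∀ p j k, σ.R (p + 1, j) = some k → σ.D (p + 1, j) ≠ none ∧ σ.D (p, k) ≠ none
  /-- (C3), level `≥ 1` -/
  D_V : ∀ p j, σ.D (p + 1, j) ≠ none → σ.V (p + 1, j) ≠ none
  /-- (C3), level `0` -/
  D_I : ∀ j, σ.D (0, j) ≠ none → σ.I j ≠ none
  /-- (C4), non-tautology -/
  D_nonTaut : ∀ i j C, σ.D (i, j) = some C → ∀ ℓ, ¬ ((ℓ, true) ∈ C ∧ (ℓ, false) ∈ C)
  /-- (C4), fatness: at least `min (s-1-i) n` literals -/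
  D_card : ∀ i j C, σ.D (i, j) = some C → C.card < P.n → P.s ≤ i + 1 + C.card
  /-- (C4), a non-full clause avoids its cut variable -/
  D_cut : ∀ i j C k, σ.D (i, j) = some C → C.card < P.n → σ.V (i, j) = some k →
    (k, true) ∉ C ∧ (k, false) ∉ C
  /-- (C5) the last clause is empty -/
  D_last : ∀ i j C, i + 1 = P.s → j + 1 = P.t → σ.D (i, j) = some C → C = ∅
  /-- (C6) a level-`0` clause contains the clause of `F` assigned to it -/
  D_F : ∀ j C m, σ.D (0, j) = some C → σ.I j = some m → Fc m ⊆ C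
  /-- (C7) for `L`: the `L`-premise contains the cut variable positively -/
  L_cut : ∀ p j k ℓ C', σ.L (p + 1, j) = some k → σ.V (p + 1, j) = some ℓ →
    σ.D (p, k) = some C' → (ℓ, true) ∈ C'
  /-- (C7) for `R`: the `R`-premise contains the cut variable negatively -/
  R_cut : ∀ p j k ℓ C', σ.R (p + 1, j) = some k → σ.V (p + 1, j) = some ℓ →
    σ.D (p, k) = some C' → (ℓ, false) ∈ C'
  /-- (C8) for `L`: all other literals of the `L`-premise are kept -/
  L_keep : ∀ p j k ℓ C C', σ.L (p + 1, j) = some k → σ.V (p + 1, j) = some ℓ →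
    σ.D (p + 1, j) = some C → σ.D (p, k) = some C' → ∀ q ∈ C', q ≠ (ℓ, true) → q ∈ C
  /-- (C8) for `R`: all other literals of the `R`-premise are kept -/
  R_keep : ∀ p j k ℓ C C', σ.R (p + 1, j) = some k → σ.V (p + 1, j) = some ℓ →
    σ.D (p + 1, j) = some C → σ.D (p, k) = some C' → ∀ q ∈ C', q ≠ (ℓ, false) → q ∈ C
  /-- (C9) `L`-premises are not shared -/
  inj_LL : ∀ i j₁ j₂ k, σ.L (i, j₁) = some k → σ.L (i, j₂) = some k → j₁ = j₂
  /-- (C9) `R`-premises are not shared -/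
  inj_RR : ∀ i j₁ j₂ k, σ.R (i, j₁) = some k → σ.R (i, j₂) = some k → j₁ = j₂
  /-- (C9) an `L`-premise is not an `R`-premise -/
  inj_LR : ∀ i j₁ j₂ k, σ.L (i, j₁) = some k → σ.R (i, j₂) ≠ some k

/-- `L` is never set on level `0`. [folklore] -/
theorem Admissible.L_zero {P : Params} {Fc : ℕ → Finset (ℕ × Bool)} {σ : PA}
    (h : Admissible P Fc σ) (j : ℕ) : σ.L (0, j) = none := by
  cases hL : σ.L (0, j) with
  | none => rfl
  | some k => exact absurd (h.L_range 0 j k hL).1 (by omega)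

/-- `R` is never set on level `0`. [folklore] -/
theorem Admissible.R_zero {P : Params} {Fc : ℕ → Finset (ℕ × Bool)} {σ : PA}
    (h : Admissible P Fc σ) (j : ℕ) : σ.R (0, j) = none := by
  cases hR : σ.R (0, j) with
  | none => rfl
  | some k => exact absurd (h.R_range 0 j k hR).1 (by omega)

/-- `V` is never set on level `0`. [folklore] -/
theorem Admissible.V_zero {P : Params} {Fc : ℕ → Finset (ℕ × Bool)} {σ : PA}
    (h : Admissible P Fc σ) (j : ℕ) : σ.V (0, j) = none := by
  cases hV : σ.V (0, j) with
  | none => rfl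
  | some k => exact absurd (h.V_range 0 j k hV).1 (by omega)

/-! ### Extension of structured assignments -/

/-- `Ext σ τ`: the structured assignment `τ` extends `σ` (every group set by `σ` is set by `τ`
to the same value). [cite: Garlik2019, Def. 15 ("extends ρ")] -/
structure Ext (σ τ : PA) : Prop where
  /-- on `D` -/
  D : ∀ q C, σ.D q = some C → τ.D q = some C
  /-- on `V` -/
  V : ∀ q k, σ.V q = some k → τ.V q = some k
  /-- on `I` -/
  I : ∀ j k, σ.I j = some k → τ.I j = some k
  /-- on `L` -/
  L : ∀ q k, σ.L q = some k → τ.L q = some k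
  /-- on `R` -/
  R : ∀ q k, σ.R q = some k → τ.R q = some k

/-- `Ext` is reflexive. [folklore] -/
theorem Ext.refl (σ : PA) : Ext σ σ :=
  ⟨fun _ _ h => h, fun _ _ h => h, fun _ _ h => h, fun _ _ h => h, fun _ _ h => h⟩

/-- `Ext` is transitive. [folklore] -/
theorem Ext.trans {σ τ υ : PA} (h₁ : Ext σ τ) (h₂ : Ext τ υ) : Ext σ υ :=
  ⟨fun q C h => h₂.D q C (h₁.D q C h), fun q k h => h₂.V q k (h₁.V q k h),
    fun j k h => h₂.I j k (h₁.I j k h), fun q k h => h₂.L q k (h₁.L q k h),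
    fun q k h => h₂.R q k (h₁.R q k h)⟩

/-- Extensions preserve the values of assigned variables. [folklore] -/
theorem Ext.eval_eq {P : Params} {σ τ : PA} (h : Ext σ τ) {x : LRefVar} {v : Bool}
    (hx : σ.eval P x = some v) : τ.eval P x = some v := by
  cases x with
  | D i j ℓ b =>
    obtain ⟨hi, hj, hℓ, C, hC, rfl⟩ := PA.eval_D_isSome hx
    rw [PA.eval_D (h.D _ _ hC) hi hj hℓ]
  | V i j ℓ =>
    obtain ⟨h1, hi, hj, hℓ, k, hk, rfl⟩ := PA.eval_V_isSome hx
    rw [PA.eval_V (h.V _ _ hk) h1 hi hj hℓ]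
  | I j m =>
    obtain ⟨hj, hm, k, hk, rfl⟩ := PA.eval_I_isSome hx
    rw [PA.eval_I (h.I _ _ hk) hj hm]
  | L i j j' =>
    obtain ⟨h1, hi, hj, hj', k, hk, rfl⟩ := PA.eval_L_isSome hx
    rw [PA.eval_L (h.L _ _ hk) h1 hi hj hj']
  | R i j j' =>
    obtain ⟨h1, hi, hj, hj', k, hk, rfl⟩ := PA.eval_R_isSome hx
    rw [PA.eval_R (h.R _ _ hk) h1 hi hj hj']

/-! ### Clauses of the refutation versus structured assignments -/

/-- `Falsi P σ E`: every literal of the refutation clause `E` (over the `ℕ`-coded variables)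
whose variable is assigned by `σ` is falsified by `σ` — condition (i) of
[Garlík 2019, Lemma 19]. [cite: Garlik2019, Lemma 19 (i)] -/
def Falsi (P : Params) (σ : PA) (E : Finset (Literal ℕ)) : Prop :=
  ∀ (x : LRefVar) (b : Bool), (x.code, b) ∈ E → σ.eval P x ≠ some b

/-- `SatBy P σ E`: some literal of `E` is satisfied by `σ`. [cite: Garlik2019, §2 (F ↾ σ)] -/
def SatBy (P : Params) (σ : PA) (E : Finset (Literal ℕ)) : Prop :=
  ∃ (x : LRefVar) (b : Bool), (x.code, b) ∈ E ∧ σ.eval P x = some b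

/-- `Falsi` is antitone in the clause. [folklore] -/
theorem Falsi.mono {P : Params} {σ : PA} {E E' : Finset (Literal ℕ)} (h : Falsi P σ E')
    (hE : E ⊆ E') : Falsi P σ E :=
  fun x b hx => h x b (hE hx)

/-- A clause falsified-where-assigned by an extension of `ρ` is not satisfied by `ρ`.
[cite: Garlik2019, Lemma 19 (the clauses considered are clauses of π ↾ ρ)] -/
theorem Falsi.not_satBy {P : Params} {ρ σ : PA} {E : Finset (Literal ℕ)} (h : Falsi P σ E)
    (hρ : Ext ρ σ) : ¬ SatBy P ρ E := by
  rintro ⟨x, b, hx, hv⟩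
  exact h x b hx (hρ.eval_eq hv)

/-! ### Mentioned and important pairs -/

section Importance

open Classical in
/-- The number of `k < N` such that the positive literal of `f k` is in `E`.
[cite: Garlik2019, Def. 13] -/
noncomputable def posCnt (E : Finset (Literal ℕ)) (f : ℕ → LRefVar) (N : ℕ) : ℕ :=
  ((Finset.range N).filter fun k => ((f k).code, true) ∈ E).card

/-- Some negative literal of `f k`, `k < N`, is in `E`. [cite: Garlik2019, Def. 13] -/
def HasNeg (E : Finset (Literal ℕ)) (f : ℕ → LRefVar) (N : ℕ) : Prop :=
  ∃ k < N, ((f k).code, false) ∈ E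

/-- `(i,j)` is `D`-mentioned (= `D`-important) in `E`: `E` contains a literal of a variable of
`D(i,j,·,·)`. [cite: Garlik2019, Def. 13] -/
def DMen (P : Params) (E : Finset (Literal ℕ)) (i j : ℕ) : Prop :=
  i < P.s ∧ j < P.t ∧ ∃ ℓ < P.n, ∃ b c : Bool, ((LRefVar.D i j ℓ b).code, c) ∈ E

/-- `(i,j)` is `V`-important in `E`: a negative `V(i,j,·)`-literal, or at least `n/2` positive
ones. [cite: Garlik2019, Def. 13] -/
def VImp (P : Params) (E : Finset (Literal ℕ)) (i j : ℕ) : Prop :=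
  1 ≤ i ∧ i < P.s ∧ j < P.t ∧
    (HasNeg E (fun ℓ => .V i j ℓ) P.n ∨ P.n ≤ 2 * posCnt E (fun ℓ => .V i j ℓ) P.n)

/-- `(0,j)` is `I`-important in `E`: a negative `I(j,·)`-literal, or at least `r/2` positive
ones. [cite: Garlik2019, Def. 13] -/
def IImp (P : Params) (E : Finset (Literal ℕ)) (j : ℕ) : Prop :=
  j < P.t ∧ (HasNeg E (fun m => .I j m) P.r ∨ P.r ≤ 2 * posCnt E (fun m => .I j m) P.r)

/-- `(i,j)` is `L`-important in `E`: a negative `L(i,j,·)`-literal, or at least `t/2` positive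
ones. [cite: Garlik2019, Def. 13] -/
def LImp (P : Params) (E : Finset (Literal ℕ)) (i j : ℕ) : Prop :=
  1 ≤ i ∧ i < P.s ∧ j < P.t ∧
    (HasNeg E (fun k => .L i j k) P.t ∨ P.t ≤ 2 * posCnt E (fun k => .L i j k) P.t)

/-- `(i,j)` is `R`-important in `E`: a negative `R(i,j,·)`-literal, or at least `t/2` positive
ones. [cite: Garlik2019, Def. 13] -/
def RImp (P : Params) (E : Finset (Literal ℕ)) (i j : ℕ) : Prop :=
  1 ≤ i ∧ i < P.s ∧ j < P.t ∧
    (HasNeg E (fun k => .R i j k) P.t ∨ P.t ≤ 2 * posCnt E (fun k => .R i j k) P.t)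

variable {P : Params} {E E' : Finset (Literal ℕ)}

/-- `posCnt` is monotone in the clause. [folklore] -/
theorem posCnt_mono (hE : E ⊆ E') (f : ℕ → LRefVar) (N : ℕ) : posCnt E f N ≤ posCnt E' f N := by
  classical
  unfold posCnt
  apply Finset.card_le_card
  intro k hk
  simp only [Finset.mem_filter] at hk ⊢
  exact ⟨hk.1, hE hk.2⟩

/-- `posCnt` is at most `N`. [folklore] -/
theorem posCnt_le (E : Finset (Literal ℕ)) (f : ℕ → LRefVar) (N : ℕ) : posCnt E f N ≤ N := by
  classical
  unfold posCnt
  exact (Finset.card_le_card (Finset.filter_subset _ _)).trans (Finset.card_range N).le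

/-- If fewer than all positive literals occur, some index is free. [folklore] -/
theorem exists_pos_not_mem {f : ℕ → LRefVar} {N : ℕ} (h : posCnt E f N < N) :
    ∃ k < N, ((f k).code, true) ∉ E := by
  classical
  by_contra hc
  push Not at hc
  apply (lt_irrefl N)
  calc N = ((Finset.range N).filter fun k => ((f k).code, true) ∈ E).card := by
        rw [Finset.filter_true_of_mem (fun k hk => hc k (Finset.mem_range.1 hk)),
          Finset.card_range]
    _ = posCnt E f N := rfl
    _ < N := h

/-- If all positive literals occur then `posCnt = N`. [folklore] -/
theorem posCnt_eq_of_forall {f : ℕ → LRefVar} {N : ℕ} (h : ∀ k < N, ((f k).code, true) ∈ E) :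
    posCnt E f N = N := by
  classical
  unfold posCnt
  rw [Finset.filter_true_of_mem (fun k hk => h k (Finset.mem_range.1 hk)), Finset.card_range]

/-- `HasNeg` is monotone in the clause. [folklore] -/
theorem HasNeg.mono {f : ℕ → LRefVar} {N : ℕ} (h : HasNeg E f N) (hE : E ⊆ E') :
    HasNeg E' f N := by
  obtain ⟨k, hk, hm⟩ := h
  exact ⟨k, hk, hE hm⟩

/-- `DMen` is monotone in the clause. [folklore] -/
theorem DMen.mono {i j : ℕ} (h : DMen P E i j) (hE : E ⊆ E') : DMen P E' i j := by
  obtain ⟨hi, hj, ℓ, hℓ, b, c, hm⟩ := h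
  exact ⟨hi, hj, ℓ, hℓ, b, c, hE hm⟩

/-- `VImp` is monotone in the clause. [folklore] -/
theorem VImp.mono {i j : ℕ} (h : VImp P E i j) (hE : E ⊆ E') : VImp P E' i j := by
  obtain ⟨h1, hi, hj, h⟩ := h
  refine ⟨h1, hi, hj, ?_⟩
  rcases h with h | h
  · exact Or.inl (h.mono hE)
  · exact Or.inr (h.trans (Nat.mul_le_mul_left 2 (posCnt_mono hE _ _)))

/-- `IImp` is monotone in the clause. [folklore] -/
theorem IImp.mono {j : ℕ} (h : IImp P E j) (hE : E ⊆ E') : IImp P E' j := by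
  obtain ⟨hj, h⟩ := h
  refine ⟨hj, ?_⟩
  rcases h with h | h
  · exact Or.inl (h.mono hE)
  · exact Or.inr (h.trans (Nat.mul_le_mul_left 2 (posCnt_mono hE _ _)))

/-- `LImp` is monotone in the clause. [folklore] -/
theorem LImp.mono {i j : ℕ} (h : LImp P E i j) (hE : E ⊆ E') : LImp P E' i j := by
  obtain ⟨h1, hi, hj, h⟩ := h
  refine ⟨h1, hi, hj, ?_⟩
  rcases h with h | h
  · exact Or.inl (h.mono hE)
  · exact Or.inr (h.trans (Nat.mul_le_mul_left 2 (posCnt_mono hE _ _)))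

/-- `RImp` is monotone in the clause. [folklore] -/
theorem RImp.mono {i j : ℕ} (h : RImp P E i j) (hE : E ⊆ E') : RImp P E' i j := by
  obtain ⟨h1, hi, hj, h⟩ := h
  refine ⟨h1, hi, hj, ?_⟩
  rcases h with h | h
  · exact Or.inl (h.mono hE)
  · exact Or.inr (h.trans (Nat.mul_le_mul_left 2 (posCnt_mono hE _ _)))

end Importance

/-- `Covered P σ E`: every group whose home pair is important (of the matching kind) in `E`
is set by `σ` — condition (ii) of [Garlík 2019, Lemma 19]. [cite: Garlik2019, Lemma 19 (ii)] -/
structure Covered (P : Params) (σ : PA) (E : Finset (Literal ℕ)) : Prop where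
  /-- `D`-mentioned pairs have their clause set -/
  D : ∀ i j, DMen P E i j → σ.D (i, j) ≠ none
  /-- `V`-important pairs have their cut variable set -/
  V : ∀ i j, VImp P E i j → σ.V (i, j) ≠ none
  /-- `I`-important pairs have their `F`-clause set -/
  I : ∀ j, IImp P E j → σ.I j ≠ none
  /-- `L`-important pairs have their `L`-premise set -/
  L : ∀ i j, LImp P E i j → σ.L (i, j) ≠ none
  /-- `R`-important pairs have their `R`-premise set -/
  R : ∀ i j, RImp P E i j → σ.R (i, j) ≠ none

/-- `Covered` is antitone in the clause. [folklore] -/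
theorem Covered.mono {P : Params} {σ : PA} {E E' : Finset (Literal ℕ)} (h : Covered P σ E')
    (hE : E ⊆ E') : Covered P σ E :=
  ⟨fun i j hm => h.D i j (hm.mono hE), fun i j hm => h.V i j (hm.mono hE),
    fun j hm => h.I j (hm.mono hE), fun i j hm => h.L i j (hm.mono hE),
    fun i j hm => h.R i j (hm.mono hE)⟩

/-- `Covered` is monotone in the assignment. [folklore] -/
theorem Covered.ext {P : Params} {σ τ : PA} {E : Finset (Literal ℕ)} (h : Covered P σ E)
    (hστ : Ext σ τ) : Covered P τ E := by
  refine ⟨fun i j hm => ?_, fun i j hm => ?_, fun j hm => ?_, fun i j hm => ?_, fun i j hm => ?_⟩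
  · cases hx : σ.D (i, j) with
    | none => exact absurd hx (h.D i j hm)
    | some C => rw [hστ.D _ _ hx]; simp
  · cases hx : σ.V (i, j) with
    | none => exact absurd hx (h.V i j hm)
    | some C => rw [hστ.V _ _ hx]; simp
  · cases hx : σ.I j with
    | none => exact absurd hx (h.I j hm)
    | some C => rw [hστ.I _ _ hx]; simp
  · cases hx : σ.L (i, j) with
    | none => exact absurd hx (h.L i j hm)
    | some C => rw [hστ.L _ _ hx]; simp
  · cases hx : σ.R (i, j) with
    | none => exact absurd hx (h.R i j hm)
    | some C => rw [hστ.R _ _ hx]; simp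

/-- The invariant of the backward walk [Garlík 2019, Lemma 19]: some admissible extension of
`ρ` falsifies `E` where it is defined and sets every important group of `E`.
[cite: Garlik2019, Lemma 19] -/
def Good (P : Params) (Fc : ℕ → Finset (ℕ × Bool)) (ρ : PA) (E : Finset (Literal ℕ)) : Prop :=
  ∃ σ : PA, Admissible P Fc σ ∧ Ext ρ σ ∧ Falsi P σ E ∧ Covered P σ E

/-- The invariant passes to sub-clauses (the weakening rule, read backwards). [folklore] -/
theorem Good.mono {P : Params} {Fc : ℕ → Finset (ℕ × Bool)} {ρ : PA}
    {E E' : Finset (Literal ℕ)} (h : Good P Fc ρ E') (hE : E ⊆ E') : Good P Fc ρ E := by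
  obtain ⟨σ, hσ, hρ, hF, hC⟩ := h
  exact ⟨σ, hσ, hρ, hF.mono hE, hC.mono hE⟩

/-! ### Width and sparsity records -/

open Classical in
/-- The per-level width bounds of a clause of the restricted refutation
([Garlík 2019, Lemma 14], here per level `i` rather than summed over all levels): at most `W`
pairs of each level are `D`-mentioned / `V`-, `I`-, `L`-, `R`-important, at most `T` positive
literals `I(j,m)` for each fixed `m`, and at most `T` positive literals `V(i,j,ℓ)` for each
fixed `i, ℓ`. [cite: Garlik2019, Lemma 14 (i)–(vii)] -/
structure Narrow (P : Params) (W T : ℕ) (E : Finset (Literal ℕ)) : Prop where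
  /-- (i) -/
  dmen : ∀ i, ((Finset.range P.t).filter fun j => DMen P E i j).card ≤ W
  /-- (iii) -/
  vimp : ∀ i, ((Finset.range P.t).filter fun j => VImp P E i j).card ≤ W
  /-- (ii) -/
  iimp : ((Finset.range P.t).filter fun j => IImp P E j).card ≤ W
  /-- (iv) -/
  limp : ∀ i, ((Finset.range P.t).filter fun j => LImp P E i j).card ≤ W
  /-- (v) -/
  rimp : ∀ i, ((Finset.range P.t).filter fun j => RImp P E i j).card ≤ W
  /-- (vi) -/
  icol : ∀ m < P.r, ((Finset.range P.t).filter fun j => ((LRefVar.I j m).code, true) ∈ E).card ≤ T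
  /-- (vii) -/
  vcol : ∀ i ℓ, 1 ≤ i → i < P.s → ℓ < P.n →
    ((Finset.range P.t).filter fun j => ((LRefVar.V i j ℓ).code, true) ∈ E).card ≤ T

open Classical in
/-- The pairs of level `i` at which the structured assignment `σ` sets some group.
[cite: Garlik2019, Def. 18 (vertices of G_σ)] -/
noncomputable def setPairs (P : Params) (σ : PA) (i : ℕ) : Finset ℕ :=
  (Finset.range P.t).filter fun j => σ.D (i, j) ≠ none ∨ σ.V (i, j) ≠ none ∨
    σ.L (i, j) ≠ none ∨ σ.R (i, j) ≠ none ∨ (i = 0 ∧ σ.I j ≠ none)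

/-- `LevelSparse P K ρ`: on every level the restriction `ρ` sets groups at at most `K` pairs
(the level bounds of [Garlík 2019, Lemma 10]). [cite: Garlik2019, Lemma 10] -/
def LevelSparse (P : Params) (K : ℕ) (ρ : PA) : Prop :=
  ∀ i, (setPairs P ρ i).card ≤ K

/-! ### Lemma 16: admissible assignments falsify no axiom -/

section Lemma16

variable {P : Params} {Fc : ℕ → Finset (ℕ × Bool)} {σ : PA}

/-- The `code`-image of a clause over `LRefVar`. [folklore] -/
def codeClause (c : Clause LRefVar) : Finset (Literal ℕ) :=
  (c.map fun l => (l.1.code, l.2)).toFinset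

/-- Membership in `codeClause`. [folklore] -/
theorem mem_codeClause {c : Clause LRefVar} {x : LRefVar} {b : Bool} :
    (x.code, b) ∈ codeClause c ↔ (x, b) ∈ c := by
  simp only [codeClause, List.mem_toFinset, List.mem_map]
  constructor
  · rintro ⟨⟨y, b'⟩, hy, he⟩
    simp only [Prod.mk.injEq] at he
    obtain ⟨he1, rfl⟩ := he
    rw [LRefVar.code_injective he1] at hy
    exact hy
  · intro h
    exact ⟨(x, b), h, rfl⟩

/-- A falsified-where-assigned literal has the opposite value. [folklore] -/
theorem Falsi.val {E : Finset (Literal ℕ)} (hF : Falsi P σ E) {x : LRefVar} {b v : Bool}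
    (hx : (x.code, b) ∈ E) (hv : σ.eval P x = some v) : v = !b := by
  have := hF x b hx
  rw [hv] at this
  cases v <;> cases b <;> simp_all

variable {E : Finset (Literal ℕ)}

/-- A negative `L`-literal of `E` forces the `L`-group (covered, falsified). [folklore] -/
theorem forced_L (hF : Falsi P σ E) (hC : Covered P σ E) {p j j' : ℕ} (hp : p + 1 < P.s)
    (hj : j < P.t) (hj' : j' < P.t) (hmem : ((LRefVar.L (p + 1) j j').code, false) ∈ E) :
    σ.L (p + 1, j) = some j' := by
  have hImp : LImp P E (p + 1) j := ⟨by omega, hp, hj, Or.inl ⟨j', hj', hmem⟩⟩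
  obtain ⟨k, hk⟩ := Option.ne_none_iff_exists'.1 (hC.L _ _ hImp)
  have h := hF.val hmem (PA.eval_L hk (by omega) hp hj hj')
  simp only [Bool.not_false, decide_eq_true_eq] at h
  rw [hk, h]

/-- A negative `R`-literal of `E` forces the `R`-group (covered, falsified). [folklore] -/
theorem forced_R (hF : Falsi P σ E) (hC : Covered P σ E) {p j j' : ℕ} (hp : p + 1 < P.s)
    (hj : j < P.t) (hj' : j' < P.t) (hmem : ((LRefVar.R (p + 1) j j').code, false) ∈ E) :
    σ.R (p + 1, j) = some j' := by
  have hImp : RImp P E (p + 1) j := ⟨by omega, hp, hj, Or.inl ⟨j', hj', hmem⟩⟩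
  obtain ⟨k, hk⟩ := Option.ne_none_iff_exists'.1 (hC.R _ _ hImp)
  have h := hF.val hmem (PA.eval_R hk (by omega) hp hj hj')
  simp only [Bool.not_false, decide_eq_true_eq] at h
  rw [hk, h]

/-- A negative `V`-literal of `E` forces the `V`-group (covered, falsified). [folklore] -/
theorem forced_V (hF : Falsi P σ E) (hC : Covered P σ E) {p j ℓ : ℕ} (hp : p + 1 < P.s)
    (hj : j < P.t) (hℓ : ℓ < P.n) (hmem : ((LRefVar.V (p + 1) j ℓ).code, false) ∈ E) :
    σ.V (p + 1, j) = some ℓ := by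
  have hImp : VImp P E (p + 1) j := ⟨by omega, hp, hj, Or.inl ⟨ℓ, hℓ, hmem⟩⟩
  obtain ⟨k, hk⟩ := Option.ne_none_iff_exists'.1 (hC.V _ _ hImp)
  have h := hF.val hmem (PA.eval_V hk (by omega) hp hj hℓ)
  simp only [Bool.not_false, decide_eq_true_eq] at h
  rw [hk, h]

/-- A negative `I`-literal of `E` forces the `I`-group (covered, falsified). [folklore] -/
theorem forced_I (hF : Falsi P σ E) (hC : Covered P σ E) {j m : ℕ} (hj : j < P.t)
    (hm : m < P.r) (hmem : ((LRefVar.I j m).code, false) ∈ E) : σ.I j = some m := by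
  have hImp : IImp P E j := ⟨hj, Or.inl ⟨m, hm, hmem⟩⟩
  obtain ⟨k, hk⟩ := Option.ne_none_iff_exists'.1 (hC.I _ hImp)
  have h := hF.val hmem (PA.eval_I hk hj hm)
  simp only [Bool.not_false, decide_eq_true_eq] at h
  rw [hk, h]

/-- A `D`-literal of `E` forces the `D`-group, with the opposite membership (covered,
falsified). [folklore] -/
theorem forced_D (hF : Falsi P σ E) (hC : Covered P σ E) {i j ℓ : ℕ} {b c : Bool}
    (hi : i < P.s) (hj : j < P.t) (hℓ : ℓ < P.n) (hmem : ((LRefVar.D i j ℓ b).code, c) ∈ E) :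
    ∃ C, σ.D (i, j) = some C ∧ ((ℓ, b) ∈ C ↔ c = false) := by
  have hImp : DMen P E i j := ⟨hi, hj, ℓ, hℓ, b, c, hmem⟩
  obtain ⟨C, hCD⟩ := Option.ne_none_iff_exists'.1 (hC.D _ _ hImp)
  have h := hF.val hmem (PA.eval_D hCD hi hj hℓ)
  refine ⟨C, hCD, ?_⟩
  cases c <;> simp_all

/-- **[Garlík 2019, Lemma 16] in the form used by the backward walk.** If an admissible
assignment sets every important group of (the `code`-image of) an axiom of `REF^F_{s,t}` and
falsifies every literal it assigns, we reach a contradiction: covering forces every variable of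
the axiom to be assigned, so the axiom would be falsified, which admissibility forbids. The
clauses `Fc m` of `F` are assumed to live over the variable indices `< n`, and `s > 0`.
[cite: Garlik2019, Lemma 16] -/
theorem not_axiom_of_covered (hσ : Admissible P Fc σ) (hs : 0 < P.s)
    (hFc : ∀ m < P.r, Fc m ⊆ Finset.range P.n ×ˢ Finset.univ) {c : Clause LRefVar}
    (hax : IsAxiom P.n P.r P.s P.t Fc c) (hF : Falsi P σ (codeClause c))
    (hC : Covered P σ (codeClause c)) : False := by
  have mem : ∀ {x : LRefVar} {b : Bool}, (x, b) ∈ c → (x.code, b) ∈ codeClause c :=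
    fun h => mem_codeClause.2 h
  cases hax with
  | @b1 j m ℓ b hj hm hℓb =>
    have hℓ : ℓ < P.n := by
      have := hFc m hm hℓb
      simp only [Finset.mem_product, Finset.mem_range] at this
      exact this.1
    have hI := forced_I hF hC hj hm (mem (x := .I j m) (b := false) (by simp))
    obtain ⟨C, hCD, hiff⟩ := forced_D hF hC (i := 0) (j := j) (ℓ := ℓ) (b := b) (c := true)
      hs hj hℓ (mem (by simp))
    exact absurd (hσ.D_F j C m hCD hI hℓb) (by simp [hiff])
  | @b2 i j ℓ hi hj hℓ =>
    obtain ⟨C, hCD, hiff⟩ := forced_D hF hC (i := i) (j := j) (ℓ := ℓ) (b := true) (c := false)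
      hi hj hℓ (mem (by simp))
    obtain ⟨C', hCD', hiff'⟩ := forced_D hF hC (i := i) (j := j) (ℓ := ℓ) (b := false)
      (c := false) hi hj hℓ (mem (by simp))
    rw [hCD] at hCD'
    cases hCD'
    exact hσ.D_nonTaut i j C hCD ℓ ⟨hiff.2 rfl, hiff'.2 rfl⟩
  | @b3 p j j' ℓ hp hj hj' hℓ =>
    have hL := forced_L hF hC hp hj hj' (mem (x := .L (p + 1) j j') (b := false) (by simp))
    have hV := forced_V hF hC hp hj hℓ (mem (x := .V (p + 1) j ℓ) (b := false) (by simp))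
    obtain ⟨C', hCD', hiff'⟩ := forced_D hF hC (i := p) (j := j') (ℓ := ℓ) (b := true)
      (c := true) (by omega) hj' hℓ (mem (by simp))
    have := hσ.L_cut p j j' ℓ C' hL hV hCD'
    simp [hiff'] at this
  | @b4 p j j' ℓ hp hj hj' hℓ =>
    have hR := forced_R hF hC hp hj hj' (mem (x := .R (p + 1) j j') (b := false) (by simp))
    have hV := forced_V hF hC hp hj hℓ (mem (x := .V (p + 1) j ℓ) (b := false) (by simp))
    obtain ⟨C', hCD', hiff'⟩ := forced_D hF hC (i := p) (j := j') (ℓ := ℓ) (b := false)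
      (c := true) (by omega) hj' hℓ (mem (by simp))
    have := hσ.R_cut p j j' ℓ C' hR hV hCD'
    simp [hiff'] at this
  | @b5 p j j' ℓ ℓ' b hp hj hj' hℓ hℓ' hne =>
    have hL := forced_L hF hC hp hj hj' (mem (x := .L (p + 1) j j') (b := false) (by simp))
    have hV := forced_V hF hC hp hj hℓ (mem (x := .V (p + 1) j ℓ) (b := false) (by simp))
    obtain ⟨C', hCD', hiff'⟩ := forced_D hF hC (i := p) (j := j') (ℓ := ℓ') (b := b)
      (c := false) (by omega) hj' hℓ' (mem (by simp))
    obtain ⟨C, hCD, hiff⟩ := forced_D hF hC (i := p + 1) (j := j) (ℓ := ℓ') (b := b)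
      (c := true) hp hj hℓ' (mem (by simp))
    have hq : (ℓ', b) ∈ C := hσ.L_keep p j j' ℓ C C' hL hV hCD hCD' _ (hiff'.2 rfl)
      (by rintro h; simp only [Prod.mk.injEq] at h; exact hne h)
    simp [hiff] at hq
  | @b6 p j j' ℓ ℓ' b hp hj hj' hℓ hℓ' hne =>
    have hR := forced_R hF hC hp hj hj' (mem (x := .R (p + 1) j j') (b := false) (by simp))
    have hV := forced_V hF hC hp hj hℓ (mem (x := .V (p + 1) j ℓ) (b := false) (by simp))
    obtain ⟨C', hCD', hiff'⟩ := forced_D hF hC (i := p) (j := j') (ℓ := ℓ') (b := b)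
      (c := false) (by omega) hj' hℓ' (mem (by simp))
    obtain ⟨C, hCD, hiff⟩ := forced_D hF hC (i := p + 1) (j := j) (ℓ := ℓ') (b := b)
      (c := true) hp hj hℓ' (mem (by simp))
    have hq : (ℓ', b) ∈ C := hσ.R_keep p j j' ℓ C C' hR hV hCD hCD' _ (hiff'.2 rfl)
      (by rintro h; simp only [Prod.mk.injEq] at h; exact hne h)
    simp [hiff] at hq
  | @b7 i j ℓ b hi hj hℓ =>
    obtain ⟨C, hCD, hiff⟩ := forced_D hF hC (i := i) (j := j) (ℓ := ℓ) (b := b) (c := false)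
      (by omega) (by omega) hℓ (mem (by simp))
    have := hσ.D_last i j C hi hj hCD
    subst this
    simp at hiff
  | @b8 p j hp hj =>
    have hall : ∀ ℓ < P.n, ((LRefVar.V (p + 1) j ℓ).code, true) ∈ codeClause _ :=
      fun ℓ hℓ => mem (List.mem_map.2 ⟨ℓ, List.mem_range.2 hℓ, rfl⟩)
    have hImp : VImp P (codeClause ((List.range P.n).map fun ℓ => (LRefVar.V (p + 1) j ℓ, true)))
        (p + 1) j := ⟨by omega, hp, hj, Or.inr (by rw [posCnt_eq_of_forall hall]; omega)⟩
    obtain ⟨k, hk⟩ := Option.ne_none_iff_exists'.1 (hC.V _ _ hImp)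
    have hkn := (hσ.V_range _ _ _ hk).2.2.2
    have h := hF.val (hall k hkn) (PA.eval_V hk (by omega) hp hj hkn)
    simp at h
  | @b9 j hj =>
    have hall : ∀ m < P.r, ((LRefVar.I j m).code, true) ∈ codeClause _ :=
      fun m hm => mem (List.mem_map.2 ⟨m, List.mem_range.2 hm, rfl⟩)
    have hImp : IImp P (codeClause ((List.range P.r).map fun m => (LRefVar.I j m, true))) j :=
      ⟨hj, Or.inr (by rw [posCnt_eq_of_forall hall]; omega)⟩
    obtain ⟨k, hk⟩ := Option.ne_none_iff_exists'.1 (hC.I _ hImp)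
    have hkr := (hσ.I_range _ _ hk).2
    have h := hF.val (hall k hkr) (PA.eval_I hk hj hkr)
    simp at h
  | @b10 p j hp hj =>
    have hall : ∀ k < P.t, ((LRefVar.L (p + 1) j k).code, true) ∈ codeClause _ :=
      fun k hk => mem (List.mem_map.2 ⟨k, List.mem_range.2 hk, rfl⟩)
    have hImp : LImp P (codeClause ((List.range P.t).map fun k => (LRefVar.L (p + 1) j k, true)))
        (p + 1) j := ⟨by omega, hp, hj, Or.inr (by rw [posCnt_eq_of_forall hall]; omega)⟩
    obtain ⟨k, hk⟩ := Option.ne_none_iff_exists'.1 (hC.L _ _ hImp)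
    have hkt := (hσ.L_range _ _ _ hk).2.2.2
    have h := hF.val (hall k hkt) (PA.eval_L hk (by omega) hp hj hkt)
    simp at h
  | @b11 p j hp hj =>
    have hall : ∀ k < P.t, ((LRefVar.R (p + 1) j k).code, true) ∈ codeClause _ :=
      fun k hk => mem (List.mem_map.2 ⟨k, List.mem_range.2 hk, rfl⟩)
    have hImp : RImp P (codeClause ((List.range P.t).map fun k => (LRefVar.R (p + 1) j k, true)))
        (p + 1) j := ⟨by omega, hp, hj, Or.inr (by rw [posCnt_eq_of_forall hall]; omega)⟩
    obtain ⟨k, hk⟩ := Option.ne_none_iff_exists'.1 (hC.R _ _ hImp)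
    have hkt := (hσ.R_range _ _ _ hk).2.2.2
    have h := hF.val (hall k hkt) (PA.eval_R hk (by omega) hp hj hkt)
    simp at h
  | @b12 p j ℓ ℓ' hp hj hℓ hℓ' hne =>
    have h1 := forced_V hF hC hp hj hℓ (mem (x := .V (p + 1) j ℓ) (b := false) (by simp))
    have h2 := forced_V hF hC hp hj hℓ' (mem (x := .V (p + 1) j ℓ') (b := false) (by simp))
    rw [h1] at h2
    cases h2
    exact hne rfl
  | @b13 j m m' hj hm hm' hne =>
    have h1 := forced_I hF hC hj hm (mem (x := .I j m) (b := false) (by simp))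
    have h2 := forced_I hF hC hj hm' (mem (x := .I j m') (b := false) (by simp))
    rw [h1] at h2
    cases h2
    exact hne rfl
  | @b14 p j j' j'' hp hj hj' hj'' hne =>
    have h1 := forced_L hF hC hp hj hj' (mem (x := .L (p + 1) j j') (b := false) (by simp))
    have h2 := forced_L hF hC hp hj hj'' (mem (x := .L (p + 1) j j'') (b := false) (by simp))
    rw [h1] at h2
    cases h2
    exact hne rfl
  | @b15 p j j' j'' hp hj hj' hj'' hne =>
    have h1 := forced_R hF hC hp hj hj' (mem (x := .R (p + 1) j j') (b := false) (by simp))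
    have h2 := forced_R hF hC hp hj hj'' (mem (x := .R (p + 1) j j'') (b := false) (by simp))
    rw [h1] at h2
    cases h2
    exact hne rfl

end Lemma16

/-! ### The backward walk through a refutation -/

/-- **The backward walk** (the concluding paragraph before [Garlík 2019, Lemma 16]): if a
property of clauses holds for the empty clause, passes from the conclusion of a resolution step
to one of its premises and from a clause to its sub-clauses (the weakening rule read backwards),
but fails on every initial clause, then there is no resolution refutation. (Take the first line
of the refutation with the property.) [cite: Garlik2019, §4 (proof of Thm 7, the paragraph
before Lemma 16)] -/
theorem no_refutation_of_invariant {ν : Type*} [DecidableEq ν] {φ : CNF ν}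
    {π : List (ResLine ν)} (hπ : IsResRefutation φ π) (Pr : Finset (Literal ν) → Prop)
    (hax : ∀ C ∈ φ.clauseFinsets, ¬ Pr C)
    (hres : ∀ (C D E : Finset (Literal ν)) (v : ν), C ∈ π.map ResLine.clause →
      D ∈ π.map ResLine.clause → E ∈ π.map ResLine.clause → IsResolvent C D v E → Pr E →
      Pr C ∨ Pr D)
    (hweak : ∀ C E : Finset (Literal ν), C ∈ π.map ResLine.clause → E ∈ π.map ResLine.clause →
      C ⊆ E → Pr E → Pr C)
    (h0 : Pr ∅) : False := by
  classical
  obtain ⟨hder, l, hl, hl0⟩ := hπ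
  have hex : ∃ k, ∃ hk : k < π.length, Pr (π[k]'hk).clause := by
    obtain ⟨k, hk, rfl⟩ := List.mem_iff_getElem.1 hl
    exact ⟨k, hk, by rw [hl0]; exact h0⟩
  set k := Nat.find hex with hkdef
  obtain ⟨hk, hPk⟩ := Nat.find_spec hex
  have hmin : ∀ i (hi : i < k), ¬ Pr (π[i]'(hi.trans hk)).clause := fun i hi hP =>
    Nat.find_min hex hi ⟨hi.trans hk, hP⟩
  have hmemk : ∀ i (hi : i < π.length), (π[i]'hi).clause ∈ π.map ResLine.clause :=
    fun i hi => List.mem_map.2 ⟨π[i], List.getElem_mem hi, rfl⟩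
  have hvalid := hder k hk
  rcases hr : (π[k]'hk).rule with _ | ⟨i, j, v⟩ | ⟨i⟩
  · simp only [IsValidResLine, hr] at hvalid
    exact hax _ hvalid hPk
  · simp only [IsValidResLine, hr] at hvalid
    obtain ⟨hi, hj, hresv⟩ := hvalid
    have hi' : i < k := (by simpa [List.length_take] using hi : i < k ∧ i < π.length).1
    have hj' : j < k := (by simpa [List.length_take] using hj : j < k ∧ j < π.length).1
    rw [List.getElem_take, List.getElem_take] at hresv
    rcases hres _ _ _ v (hmemk i (hi'.trans hk)) (hmemk j (hj'.trans hk)) (hmemk k hk) hresv hPk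
      with h | h
    · exact hmin i hi' h
    · exact hmin j hj' h
  · simp only [IsValidResLine, hr] at hvalid
    obtain ⟨hi, hsub⟩ := hvalid
    have hi' : i < k := (by simpa [List.length_take] using hi : i < k ∧ i < π.length).1
    rw [List.getElem_take] at hsub
    exact hmin i hi' (hweak _ _ (hmemk i (hi'.trans hk)) (hmemk k hk) hsub hPk)

end LevelledRefCNF

end Literature.Computability.MetaComplexity
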